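import Summits.BirchSwinnertonDyer.BirchSwinnertonDyer.Theorems.ManinLocalTwoThreeDyadicUntwistTransport
import Summits.BirchSwinnertonDyer.BirchSwinnertonDyer.Theorems.ManinLocalTwoThreeOddUntwistReductions
import Summits.BirchSwinnertonDyer.BirchSwinnertonDyer.Theorems.ManinLocalTwoThreeManinPrimeToThreeAtNineTernaryTwistConductor
import HarnessLib

/-!
# Route `ManinLocalTwoThree`, RESIDUAL crux C5 `ManinPrimeToAdditiveFiveLe` (stmt-BirchSwinnertonDyer-22969):
# **C5 ⟸ Manin at `p ≥ 5` on the GLOBALLY TWIST-MINIMAL additive classes**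

The residual conjunct of the route (declared residual, not attacked by the cell) is «`p ≥ 5`, `p² ∣ N` ⟹
`p ∤ c`» for lattice-optimal data, modulo the four printed facts. The twist machinery landed for C2/C3
applies verbatim at every `p ≥ 5`, so the same reduction is recorded here for the planner's benefit:
`ManinPrimeToAdditiveFiveLe` FOLLOWS from its restriction to the classes admitting NO semistable untwist
at any single prime — no `χ_{q*}`-untwist (`q` odd, `q² ∣ N`; the case `q = p` is the twist-COVERED case
at `p`, closed outright by the line prover p1's side-condition-free certificate
`ManinLocalTwoThree.not_dvd_maninConstant_of_isIsogenous_twist_of_not_sq_dvd`, i.e. Stevens (5.2) +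
Česnavičius 2018 at the `p`-semistable partner) and no dyadic `χ₋₄/χ_{±8}`-untwist (`4 ∣ N`, partner
`4 ∤ N'`). Strong induction on the level with the transport lemmas
`maninLocalTwoThree_not_dvd_maninConstant_of_oddUntwist` / `…_of_dyadicUntwist_semistable` at the prime
`p` (`p² ∣ N` is inherited by every partner since the untwisting characters are unramified at `p`).
So on the whole route the open content is uniformly: Manin's conjecture at an additive prime `p` for the
optimal curves whose class is twist-minimal at EVERY prime (potentially good at `p` with `e_p ≥ 3`, no odd
prime of type `I₀*`/`Iₙ*`, no dyadic semistable partner). Nothing here proves BSD or Manin's conjecture.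
Seat bsd-line-manin23-p2.

References: [Stevens1989] Lemmas (5.2), (5.4); [Cesnavicius2018] Thm. 1.2; [EdixhovenManin1991] §1;
[SilvermanATAEC1994] IV.9.4.
-/

set_option autoImplicit false
set_option linter.dupNamespace false

noncomputable section

open scoped Classical NumberField

namespace Summit.BirchSwinnertonDyer.BirchSwinnertonDyer.Theorems

open WeierstrassCurve IsDedekindDomain IsDedekindDomain.HeightOneSpectrum Rat.HeightOneSpectrum
  Literature.NumberTheory.Automorphic
  Literature.NumberTheory.EllipticCurves Literature.NumberTheory.EllipticCurves.ModularForms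

/-- **Residual crux C5 `ManinPrimeToAdditiveFiveLe` ⟸ Manin at `p ≥ 5` on the globally twist-minimal
classes** (one hypothesis, mod the printed facts): for every `p ≥ 5`, every globally minimal `W` with a
lattice-optimal `X₀(N)`-datum, `p² ∣ N`, whose class admits no `χ_{q*}`-untwist to a `q`-semistable class
(`q` odd, `q² ∣ N`) and no dyadic untwist to a `2`-semistable class (`4 ∣ N`), `p ∤ c`.
[cite: Stevens1989, Lemmas (5.2), (5.4)] [cite: Cesnavicius2018, Thm. 1.2] [cite: EdixhovenManin1991, §1] -/
theorem maninLocalTwoThree_maninPrimeToAdditiveFiveLe_of_globallyTwistMinimal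
    (H : Literature.NumberTheory.EllipticCurves.ModularForms.mazur_not_dvd_maninConstant_of_odd →
      Literature.NumberTheory.EllipticCurves.ModularForms.abbesUllmo_not_dvd_maninConstant_of_not_dvd_level →
      Literature.NumberTheory.EllipticCurves.ModularForms.cesnavicius_not_two_dvd_maninConstant_of_two_dvd_level →
      Literature.NumberTheory.EllipticCurves.ModularForms.exists_isNewformOf →
      ∀ (W : WeierstrassCurve ℚ) [W.IsElliptic] [W.IsGloballyMinimal] {N : ℕ} [NeZero N]
        (D : ModularParametrizationData W N),
        (∀ z ∈ D.L.lattice, ∃ w ∈ periodLattice D.f, z = D.c * w) →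
        ∀ p : ℕ, p.Prime → 5 ≤ p → p ^ 2 ∣ N →
        ¬ (∃ (W' : WeierstrassCurve ℚ) (q : ℕ), W'.IsElliptic ∧ W'.IsGloballyMinimal ∧
          q.Prime ∧ q ≠ 2 ∧ q ^ 2 ∣ N ∧
          IsIsogenous W (W'.quadraticTwist (((-1 : ℤ) ^ (q / 2) * q : ℤ) : ℚ)) ∧
          ¬ q ^ 2 ∣ W'.conductorNorm ℤ) →
        ¬ (∃ (W' : WeierstrassCurve ℚ) (d : ℤ), W'.IsElliptic ∧ W'.IsGloballyMinimal ∧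
          (d = -1 ∨ d = 2 ∨ d = -2) ∧ 2 ^ 2 ∣ N ∧ IsIsogenous W (W'.quadraticTwist (d : ℚ)) ∧
          ¬ 2 ^ 2 ∣ W'.conductorNorm ℤ) →
        ¬ (p : ℤ) ∣ D.maninConstant) :
    Summit.BirchSwinnertonDyer.BirchSwinnertonDyer.Theses.ManinLocalTwoThree.ManinPrimeToAdditiveFiveLe := by
  intro hM hAU hC2 hnf
  have hmod : nonempty_modularParametrizationData :=
    maninLocalTwoThree_nonempty_modularParametrizationData_of_exists_isNewformOf hnf
  -- `p² ∣ N` passes to an isogenous curve twisted by a character unramified at `p`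
  have sqp : ∀ {p : ℕ} (hp : p.Prime) {W W' : WeierstrassCurve ℚ} [W.IsElliptic] [W'.IsElliptic] {e : ℤ}
      (he0 : (e : ℚ) ≠ 0)
      (hfe : (W'.quadraticTwist (e : ℚ)).conductorExponent ((primesEquiv (R := ℤ)).symm ⟨p, hp⟩) =
          W'.conductorExponent ((primesEquiv (R := ℤ)).symm ⟨p, hp⟩)),
      IsIsogenous W (W'.quadraticTwist (e : ℚ)) → p ^ 2 ∣ W.conductorNorm ℤ →
      p ^ 2 ∣ W'.conductorNorm ℤ := by
    intro p hp W W' _ _ e he0 hfe htw hsq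
    haveI : (W'.quadraticTwist (e : ℚ)).IsElliptic := W'.isElliptic_quadraticTwist he0
    have hWV : W.conductorNorm ℤ = (W'.quadraticTwist (e : ℚ)).conductorNorm ℤ :=
      conductorNorm_eq_of_isIsogenous_of_modularity hmod _ _ htw
    have h2 : 2 ≤ (W.conductorNorm ℤ).factorization p :=
      (hp.pow_dvd_iff_le_factorization (conductorNorm_pos_holds W).ne').mp hsq
    refine (hp.pow_dvd_iff_le_factorization (conductorNorm_pos_holds W').ne').mpr ?_
    have e1 := factorization_conductorNorm_primesEquiv_symm (W'.quadraticTwist (e : ℚ)) ⟨p, hp⟩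
    have e2 := factorization_conductorNorm_primesEquiv_symm W' ⟨p, hp⟩
    simp only at e1 e2
    rw [e2, ← hfe, ← e1, ← hWV]
    exact h2
  suffices key : ∀ (n : ℕ) (W : WeierstrassCurve ℚ) [W.IsElliptic] [W.IsGloballyMinimal] (N : ℕ)
      [NeZero N] (D : ModularParametrizationData W N), N < n →
      (∀ z ∈ D.L.lattice, ∃ w ∈ periodLattice D.f, z = D.c * w) →
      ∀ p : ℕ, p.Prime → 5 ≤ p → p ^ 2 ∣ N → ¬ (p : ℤ) ∣ D.maninConstant by
    intro W _ _ N _ D hopt p hp h5 hpN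
    exact key (N + 1) W N D (Nat.lt_succ_self N) hopt p hp h5 hpN
  intro n
  induction n with
  | zero => intro W _ _ N _ D hN; exact absurd hN (Nat.not_lt_zero N)
  | succ n ih =>
    intro W _ _ N _ D hNn hopt p hp h5 hpN
    haveI hpF : Fact p.Prime := ⟨hp⟩
    have hp2 : p ≠ 2 := by omega
    have hN : N = W.conductorNorm ℤ :=
      IsNewformOf.level_eq_conductorNorm_of_exists_isNewformOf hnf D.isNewformOf
    have hpNW : p ^ 2 ∣ W.conductorNorm ℤ := hN ▸ hpN
    by_cases hodd : ∃ (W' : WeierstrassCurve ℚ) (q : ℕ), W'.IsElliptic ∧ W'.IsGloballyMinimal ∧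
        q.Prime ∧ q ≠ 2 ∧ q ^ 2 ∣ N ∧
        IsIsogenous W (W'.quadraticTwist (((-1 : ℤ) ^ (q / 2) * q : ℤ) : ℚ)) ∧
        ¬ q ^ 2 ∣ W'.conductorNorm ℤ
    · obtain ⟨W', q, hE', hM', hqp, hq2, hqN, htw, hqN'⟩ := hodd
      haveI := hE'
      haveI := hM'
      haveI : Fact q.Prime := ⟨hqp⟩
      by_cases hqp' : q = p
      · -- the twist-covered case at `p` itself: closed by the tree (line prover p1's certificate)
        subst hqp'
        exact ManinLocalTwoThree.not_dvd_maninConstant_of_isIsogenous_twist_of_not_sq_dvd hM hAU hC2 hnf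
          hqp hq2 W D hopt hqN W' htw hqN'
      · refine maninLocalTwoThree_not_dvd_maninConstant_of_oddUntwist hnf hq2 D hopt hqN htw hqN' ?_
        intro W₁ _ _ N₁ _ D₁ hiso₁ hopt₁
        have hd0 : ((((-1 : ℤ) ^ (q / 2) * q : ℤ)) : ℚ) ≠ 0 := by
          push_cast
          exact mul_ne_zero (pow_ne_zero _ (by norm_num)) (by exact_mod_cast hqp.ne_zero)
        have hN₁ : N₁ = W'.conductorNorm ℤ := level_eq_conductorNorm_of_isIsogenous hnf D₁ hiso₁
        have hadd : ¬ W.HasGoodReductionAtPrime q ∧ ¬ W.HasMultiplicativeReductionAtPrime q :=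
          Summit.BirchSwinnertonDyer.Rank1Residual.ManinAdditive.not_good_and_not_mult_of_sq_dvd_conductorNorm
            W (hN ▸ hqN)
        have hN'N : W'.conductorNorm ℤ ∣ W.conductorNorm ℤ :=
          maninLocalTwoThree_conductorNorm_dvd_of_isIsogenous_twist_pStar hnf hq2 htw hqN' hadd
        have hlt : N₁ < N := by
          rw [hN₁, hN]
          refine lt_of_le_of_ne (Nat.le_of_dvd (conductorNorm_pos_holds W) hN'N) fun h ↦ hqN' ?_
          rw [h]; exact hN ▸ hqN
        have hvp : natGenerator ((primesEquiv (R := ℤ)).symm ⟨p, hp⟩) ≠ q := by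
          rw [natGenerator_primesEquiv_symm hp]; exact fun h ↦ hqp' h.symm
        have hpW' : p ^ 2 ∣ W'.conductorNorm ℤ := by
          have hf := maninLocalTwoThree_conductorExponent_eq_of_isIsogenous_twist_pStar hnf hq2 htw
            ((primesEquiv (R := ℤ)).symm ⟨p, hp⟩) hvp
          have h2 : 2 ≤ (W.conductorNorm ℤ).factorization p :=
            (hp.pow_dvd_iff_le_factorization (conductorNorm_pos_holds W).ne').mp hpNW
          refine (hp.pow_dvd_iff_le_factorization (conductorNorm_pos_holds W').ne').mpr ?_
          have e1 := factorization_conductorNorm_primesEquiv_symm W ⟨p, hp⟩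
          have e2 := factorization_conductorNorm_primesEquiv_symm W' ⟨p, hp⟩
          simp only at e1 e2
          rw [e2, ← hf, ← e1]
          exact h2
        exact ih W₁ N₁ D₁ (by omega) hopt₁ p hp h5 (hN₁ ▸ hpW')
    · by_cases hdy : ∃ (W' : WeierstrassCurve ℚ) (d : ℤ), W'.IsElliptic ∧ W'.IsGloballyMinimal ∧
          (d = -1 ∨ d = 2 ∨ d = -2) ∧ 2 ^ 2 ∣ N ∧ IsIsogenous W (W'.quadraticTwist (d : ℚ)) ∧
          ¬ 2 ^ 2 ∣ W'.conductorNorm ℤ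
      · obtain ⟨W', d, hE', hM', hd, h4, htw, h4N'⟩ := hdy
        haveI := hE'
        haveI := hM'
        refine maninLocalTwoThree_not_dvd_maninConstant_of_dyadicUntwist_semistable hnf D hopt h4 hd htw
          h4N' ?_
        intro W₁ _ _ N₁ _ D₁ hiso₁ hopt₁
        have hdne : d ≠ 0 := by rcases hd with rfl | rfl | rfl <;> norm_num
        have hd0 : (d : ℚ) ≠ 0 := by exact_mod_cast hdne
        have hN₁ : N₁ = W'.conductorNorm ℤ := level_eq_conductorNorm_of_isIsogenous hnf D₁ hiso₁
        have hadd : ¬ W.HasGoodReductionAtPrime 2 ∧ ¬ W.HasMultiplicativeReductionAtPrime 2 := by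
          haveI : Fact (Nat.Prime 2) := ⟨Nat.prime_two⟩
          exact Summit.BirchSwinnertonDyer.Rank1Residual.ManinAdditive.not_good_and_not_mult_of_sq_dvd_conductorNorm
            W (hN ▸ h4)
        have hN'N : W'.conductorNorm ℤ ∣ W.conductorNorm ℤ :=
          (stub_dyadicTwistConductor hnf hd htw h4N' hadd).1
        have hlt : N₁ < N := by
          rw [hN₁, hN]
          refine lt_of_le_of_ne (Nat.le_of_dvd (conductorNorm_pos_holds W) hN'N) fun h ↦ h4N' ?_
          rw [h]; exact hN ▸ h4
        have hfe : (W'.quadraticTwist (d : ℚ)).conductorExponent ((primesEquiv (R := ℤ)).symm ⟨p, hp⟩) =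
            W'.conductorExponent ((primesEquiv (R := ℤ)).symm ⟨p, hp⟩) :=
          maninLocalTwoThree_conductorExponent_quadraticTwist_eq_of_ne_two W' hd _
            (by rw [natGenerator_primesEquiv_symm hp]; exact hp2)
        have hpW' : p ^ 2 ∣ W'.conductorNorm ℤ := sqp hp hd0 hfe htw hpNW
        exact ih W₁ N₁ D₁ (by omega) hopt₁ p hp h5 (hN₁ ▸ hpW')
      · exact H hM hAU hC2 hnf W D hopt p hp h5 hpN hodd hdy

end Summit.BirchSwinnertonDyer.BirchSwinnertonDyer.Theorems

end
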